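import Summits.CriticalPhenomena.SAWScalingLimit.Theorems.HexTight.Negative.LatticeG2Defs

/-!
# Ring counterexample to lattice G2 for crux `HexTight` (stmt-CriticalPhenomena-5423), part 2:
the ring `Finset`, far cells, the real-part dichotomy

The ring of cells with columns `i = -3K`, `i = K` and rows `j = 0`, `j = 2K` (`ring K`), its
membership lemmas, and the two metric facts used by the refutation in `Negative/LatticeG2False.lean`:
off the bottom row the ring is at distance `≥ K` from the centre `x = c(U(0,0))` (`far_of_mem_ring`),
and a ring cell at distance in `(0, K)` has real part `≥ Re x + 1/2` or `≤ Re x - 1/2`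
(`re_dichotomy`).
-/

noncomputable section

open scoped BigOperators
open Classical
open Literature.Probability.LatticeModels
open Literature.Probability.RandomPlanarGeometry.SAW

namespace Summit.CriticalPhenomena.SAWScalingLimit.Cruxes.HexTight.Negative

/-! ## The ring -/

/-- Membership predicate of the ring with columns at `i = -3K` and `i = K`, rows `j = 0` and `j = 2K`:
bottom row `U(i,0)` (`-3K < i ≤ K`), `D(i,0)` (`-3K ≤ i ≤ K`); right column `U(K,j)` (`1 ≤ j ≤ 2K`),
`D(K,j)` (`1 ≤ j ≤ 2K-1`); top row `U(i,2K)`, `D(i,2K)` (`-3K ≤ i ≤ K-1`); left column `U(-3K,j)`,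
`D(-3K,j)` (`1 ≤ j ≤ 2K-1`). -/
def InRing (K : ℕ) (y : HexVertex) : Prop :=
  (y.1 1 = 0 ∧ -(3 * K : ℤ) ≤ y.1 0 ∧ y.1 0 ≤ K ∧ (y.2 = 0 → -(3 * K : ℤ) < y.1 0)) ∨
  (y.1 0 = K ∧ 1 ≤ y.1 1 ∧ y.1 1 ≤ 2 * K ∧ (y.2 = 1 → y.1 1 ≤ 2 * K - 1)) ∨
  (y.1 1 = 2 * K ∧ -(3 * K : ℤ) ≤ y.1 0 ∧ y.1 0 ≤ K - 1) ∨
  (y.1 0 = -(3 * K : ℤ) ∧ 1 ≤ y.1 1 ∧ y.1 1 ≤ 2 * K - 1)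

/-- The ring as a `Finset`. -/
def ring (K : ℕ) : Finset HexVertex :=
  (box 2 (3 * K) ×ˢ (Finset.univ : Finset (Fin 2))).filter (InRing K)

/-- membership in the ring `Finset` is the predicate `InRing` -/
theorem mem_ring {K : ℕ} {y : HexVertex} : y ∈ ring K ↔ InRing K y := by
  rw [ring, Finset.mem_filter, Finset.mem_product, mem_box]
  constructor
  · exact fun h => h.2
  · intro h
    refine ⟨⟨fun i => ?_, Finset.mem_univ _⟩, h⟩
    rcases h with h | h | h | h <;> fin_cases i <;> simp <;> omega

/-- the up faces of the ring -/
theorem U_mem_ring {K : ℕ} {i j : ℤ} : U i j ∈ ring K ↔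
    (j = 0 ∧ -(3 * K : ℤ) < i ∧ i ≤ K) ∨ (i = K ∧ 1 ≤ j ∧ j ≤ 2 * K) ∨
    (j = 2 * K ∧ -(3 * K : ℤ) ≤ i ∧ i ≤ K - 1) ∨ (i = -(3 * K : ℤ) ∧ 1 ≤ j ∧ j ≤ 2 * K - 1) := by
  rw [mem_ring, InRing]
  simp only [U, vec2_zero, vec2_one]
  constructor
  · rintro (h | h | h | h)
    · exact Or.inl ⟨h.1, h.2.2.2 (by decide), h.2.2.1⟩
    · exact Or.inr (Or.inl ⟨h.1, h.2.1, h.2.2.1⟩)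
    · exact Or.inr (Or.inr (Or.inl h))
    · exact Or.inr (Or.inr (Or.inr h))
  · rintro (h | h | h | h)
    · exact Or.inl ⟨h.1, h.2.1.le, h.2.2, fun _ => h.2.1⟩
    · exact Or.inr (Or.inl ⟨h.1, h.2.1, h.2.2, fun h' => absurd h' (by decide)⟩)
    · exact Or.inr (Or.inr (Or.inl h))
    · exact Or.inr (Or.inr (Or.inr h))

/-- the down faces of the ring -/
theorem D_mem_ring {K : ℕ} {i j : ℤ} : D i j ∈ ring K ↔
    (j = 0 ∧ -(3 * K : ℤ) ≤ i ∧ i ≤ K) ∨ (i = K ∧ 1 ≤ j ∧ j ≤ 2 * K - 1) ∨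
    (j = 2 * K ∧ -(3 * K : ℤ) ≤ i ∧ i ≤ K - 1) ∨ (i = -(3 * K : ℤ) ∧ 1 ≤ j ∧ j ≤ 2 * K - 1) := by
  rw [mem_ring, InRing]
  simp only [D, vec2_zero, vec2_one]
  constructor
  · rintro (h | h | h | h)
    · exact Or.inl ⟨h.1, h.2.1, h.2.2.1⟩
    · exact Or.inr (Or.inl ⟨h.1, h.2.1, h.2.2.2 (by decide)⟩)
    · exact Or.inr (Or.inr (Or.inl h))
    · exact Or.inr (Or.inr (Or.inr h))
  · rintro (h | h | h | h)
    · exact Or.inl ⟨h.1, h.2.1, h.2.2, fun h' => absurd h' (by decide)⟩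
    · refine Or.inr (Or.inl ⟨h.1, h.2.1, by omega, fun _ => h.2.2⟩)
    · exact Or.inr (Or.inr (Or.inl h))
    · exact Or.inr (Or.inr (Or.inr h))


/-- **Off the bottom row the ring is far**: distance `≥ K` from the centre. -/
theorem far_of_mem_ring {K : ℕ} {y : HexVertex} (hy : y ∈ ring K) (hj : y.1 1 ≠ 0) :
    (K : ℝ) ≤ dist (hexCenter y) x₀ := by
  have h13 := one_le_sqrt3
  have hK0 : (0 : ℝ) ≤ K := Nat.cast_nonneg _
  rcases face_eq y with hyU | hyD
  · rw [hyU] at hy ⊢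
    set i := y.1 0
    set j := y.1 1
    have hre := abs_re_le_dist (hexCenter (U i j))
    have him := abs_im_le_dist (hexCenter (U i j))
    rw [re_U, x₀_re] at hre
    rw [im_U, x₀_im] at him
    rcases U_mem_ring.1 hy with h | h | h | h
    · exact absurd h.1 hj
    · obtain ⟨hi, hj1, -⟩ := h
      have hi' : (i : ℝ) = K := by exact_mod_cast hi
      have hj1' : (1 : ℝ) ≤ j := by exact_mod_cast hj1
      rw [abs_of_nonneg (by rw [hi']; linarith)] at hre
      linarith
    · obtain ⟨hjK, -, -⟩ := h
      have hjK' : (j : ℝ) = 2 * K := by exact_mod_cast hjK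
      rw [hjK', abs_of_nonneg (by nlinarith)] at him
      nlinarith
    · obtain ⟨hi, -, hj2⟩ := h
      have hi' : (i : ℝ) = -(3 * K) := by exact_mod_cast hi
      have hj2' : (j : ℝ) ≤ 2 * K - 1 := by exact_mod_cast hj2
      rw [abs_of_nonpos (by rw [hi']; linarith)] at hre
      linarith
  · rw [hyD] at hy ⊢
    set i := y.1 0
    set j := y.1 1
    have hre := abs_re_le_dist (hexCenter (D i j))
    have him := abs_im_le_dist (hexCenter (D i j))
    rw [re_D, x₀_re] at hre
    rw [im_D, x₀_im] at him
    rcases D_mem_ring.1 hy with h | h | h | h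
    · exact absurd h.1 hj
    · obtain ⟨hi, hj1, -⟩ := h
      have hi' : (i : ℝ) = K := by exact_mod_cast hi
      have hj1' : (1 : ℝ) ≤ j := by exact_mod_cast hj1
      rw [abs_of_nonneg (by rw [hi']; linarith)] at hre
      linarith
    · obtain ⟨hjK, -, -⟩ := h
      have hjK' : (j : ℝ) = 2 * K := by exact_mod_cast hjK
      rw [hjK', abs_of_nonneg (by nlinarith)] at him
      nlinarith
    · obtain ⟨hi, -, hj2⟩ := h
      have hi' : (i : ℝ) = -(3 * K) := by exact_mod_cast hi
      have hj2' : (j : ℝ) ≤ 2 * K - 1 := by exact_mod_cast hj2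
      rw [abs_of_nonpos (by rw [hi']; linarith)] at hre
      linarith

/-- **Dichotomy.** A ring cell at distance in `(0, K)` from the centre lies on the bottom row, off
the centre, so its real part is `≥ Re x + 1/2` or `≤ Re x - 1/2`. -/
theorem re_dichotomy {K : ℕ} {y : HexVertex} (hy : y ∈ ring K) (hpos : 0 < dist (hexCenter y) x₀)
    (hlt : dist (hexCenter y) x₀ < K) :
    x₀.re + 1 / 2 ≤ (hexCenter y).re ∨ (hexCenter y).re ≤ x₀.re - 1 / 2 := by
  have hj : y.1 1 = 0 := by
    by_contra hj
    exact absurd (far_of_mem_ring hy hj) (not_le.2 hlt)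
  rw [x₀_re]
  rcases face_eq y with hyU | hyD
  · rw [hyU, hj] at hpos ⊢
    rw [re_U]
    have hi : y.1 0 ≠ 0 := by
      intro hi
      rw [hi] at hpos
      exact absurd hpos (by rw [x₀]; simp)
    rcases lt_or_gt_of_ne hi with hi | hi
    · right
      have : (y.1 0 : ℝ) ≤ -1 := by exact_mod_cast (show y.1 0 ≤ -1 by omega)
      push_cast; linarith
    · left
      have : (1 : ℝ) ≤ y.1 0 := by exact_mod_cast (show 1 ≤ y.1 0 by omega)
      push_cast; linarith
  · rw [hyD, hj]
    rw [re_D]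
    rcases lt_or_ge (y.1 0) 0 with hi | hi
    · right
      have : (y.1 0 : ℝ) ≤ -1 := by exact_mod_cast (show y.1 0 ≤ -1 by omega)
      push_cast; linarith
    · left
      have : (0 : ℝ) ≤ y.1 0 := by exact_mod_cast hi
      push_cast; linarith

end Summit.CriticalPhenomena.SAWScalingLimit.Cruxes.HexTight.Negative

end
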